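import Summits.CriticalPhenomena.PercolationContinuityZ3.Theorems.PercNearOneGluingAdditiveGluingKnThm2GoodEvents
import HarnessLib

/-! # Crux `PercNearOneGluing.AdditiveGluing` (stmt-CriticalPhenomena-4576): three relays —
# the bad-region certificate (T1) reduced to the "Lemma-2 defect ≤ room" inequality (K3a)

Support file (`--supports stmt-CriticalPhenomena-4576`, lead prim-png-lead-4576, line `starglue` v10).  No definitions,
no named facts, no sorries.

Setting and notation as in `…ThreeRelaysRegion` (deep seat r2): complete weighted graph on `Fin n`, three distinct relays
`a₁ a₂ a₃` with `a₃` worst, target `b`, observer `o`; `N₁₂ = {a₁↮a₃} ∩ {a₂↮a₃}`, `N₁ = {a₁↮a₂} ∩ {a₁↮a₃}`,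
`N₂ = {a₂↮a₁} ∩ {a₂↮a₃}`, `Pₖ = μ(Nₖ)`, `A₁₂ = μ(N₁₂ ∩ {a₁↔o ∨ a₂↔o})`, `Aₖ = μ(Nₖ ∩ {aₖ↔o})`, the atoms
`m₃ = μ(N₁₂ ∩ a₃↔b)`, `m₁₂ = μ(N₁₂ ∩ a₁↔b ∩ a₂↔b)`, `m₁ = μ(N₁ ∩ a₁↔b)`, `m₂₃ = μ(N₁ ∩ a₂↔b ∩ a₃↔b)`,
`m₂ = μ(N₂ ∩ a₂↔b)`, `m₁₃ = μ(N₂ ∩ a₁↔b ∩ a₃↔b)`, and the additive room `D = μ(o↮A, a₃↮b)`.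

Writing `φ₁₂ = A₁₂/P₁₂`, `φₖ = Aₖ/Pₖ`, the registered certificate (T1) (`stub_regionCertThreeRelays_d2`) is, after
clearing denominators, `PHI := φ₁₂(m₁₂−m₃) + φ₁(m₁−m₂₃) + φ₂(m₂−m₁₃) + D ≥ 0`, and Kozma–Nitzan's identity
`τₖ − τ₃ = (m₁₂ + mₖ) − (m_{j3} + m₃)` (`knThm2_tau_sub`, arXiv:2401.12397 p. 9, eq. (7)) rewrites it as
`PHI = D + φ₁(τ₁−τ₃) + φ₂(τ₂−τ₃) − ε·δ`,  `ε := φ₁₂ − φ₁ − φ₂` (the defect in KN's Lemma 2, `ε ≥ 0`),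
`δ := m₃ − m₁₂` (the bad-region excess).  Hence (T1) follows from the single inequality

  (K3a)   `(A₁₂P₁P₂ − A₁P₁₂P₂ − A₂P₁₂P₁)·(m₃ − m₁₂) ≤ P₁P₂P₁₂·D`   (i.e. `ε·δ ≤ D`)

whenever `a₃` is a worst relay.  This file proves exactly that reduction:
* `threeRelays_cert_of_defect_arith` — the real-arithmetic core;
* `threeRelays_regionCert_of_defectBound` — the measure form: (K3a) at `(w,o,b,a₁,a₂,a₃)` with `τ₃ ≤ τ₁, τ₂` gives the
  conclusion of (T1) verbatim (the polynomial displayed in `stub_regionCertThreeRelays_d2`).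
Numerics (lead prim, exact engine, item evidence LeadMath-prim.md §2): on the region {a₃ worst, τ(o)<τ₃, m₁₂<m₃} the ratio
`ε·δ/D` never exceeded 0.07 (adversarial n ≤ 6, ≈10⁵ instances); so (K3a) is the natural sharper target behind (T1).
[cite: KozmaNitzan2024, Theorem 2 (§3.2, pp. 8–9), Lemma 2 (p. 6)]
-/

namespace Summit.CriticalPhenomena.PercolationContinuityZ3.Theorems

open MeasureTheory Set Literature.Probability.LatticeModels Literature.Probability.Percolation

noncomputable section
open Classical

variable {n : ℕ}

/-- **Arithmetic core of the reduction (T1) ⟸ (K3a).**  With nonnegative `A₁, A₂, P₁, P₂, P₁₂`, the worst-relay gaps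
`γ₁ = (m₁₂+m₁) − (m₂₃+m₃) ≥ 0`, `γ₂ = (m₁₂+m₂) − (m₁₃+m₃) ≥ 0` and the defect bound
`(A₁₂P₁P₂ − A₁P₁₂P₂ − A₂P₁₂P₁)(m₃−m₁₂) ≤ P₁P₂P₁₂·D`, Kozma–Nitzan's certificate plus room is nonnegative.
[cite: KozmaNitzan2024, Theorem 2, proof (p. 9)] -/
theorem threeRelays_cert_of_defect_arith {A₁₂ A₁ A₂ P₁₂ P₁ P₂ m₁₂ m₃ m₁ m₂₃ m₂ m₁₃ D : ℝ}
    (hA₁ : 0 ≤ A₁) (hA₂ : 0 ≤ A₂) (hP₁₂ : 0 ≤ P₁₂) (hP₁ : 0 ≤ P₁) (hP₂ : 0 ≤ P₂)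
    (hγ₁ : 0 ≤ (m₁₂ + m₁) - (m₂₃ + m₃)) (hγ₂ : 0 ≤ (m₁₂ + m₂) - (m₁₃ + m₃))
    (hK : (A₁₂ * P₁ * P₂ - A₁ * P₁₂ * P₂ - A₂ * P₁₂ * P₁) * (m₃ - m₁₂) ≤ P₁ * P₂ * P₁₂ * D) :
    0 ≤ A₁₂ * P₁ * P₂ * (m₁₂ - m₃) + A₁ * P₁₂ * P₂ * (m₁ - m₂₃) + A₂ * P₁₂ * P₁ * (m₂ - m₁₃)
      + P₁ * P₂ * P₁₂ * D := by
  have h1 : 0 ≤ A₁ * P₁₂ * P₂ * ((m₁₂ + m₁) - (m₂₃ + m₃)) :=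
    mul_nonneg (mul_nonneg (mul_nonneg hA₁ hP₁₂) hP₂) hγ₁
  have h2 : 0 ≤ A₂ * P₁₂ * P₁ * ((m₁₂ + m₂) - (m₁₃ + m₃)) :=
    mul_nonneg (mul_nonneg (mul_nonneg hA₂ hP₁₂) hP₁) hγ₂
  nlinarith [h1, h2, hK]

/-- **(T1) from (K3a), measure form.**  For three distinct relays with `a₃` worst (`τ₃ ≤ τ₁`, `τ₃ ≤ τ₂`), the
defect bound (K3a) `(A₁₂P₁P₂ − A₁P₁₂P₂ − A₂P₁₂P₁)(m₃−m₁₂) ≤ P₁P₂P₁₂·μ(o↮A, a₃↮b)` implies the conclusion of the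
registered certificate `stub_regionCertThreeRelays_d2` verbatim (no use of `τ(o) < τ₃` or `m₁₂ < m₃` is needed for
this step; they only restrict where (K3a) has to be proved).  Proof: `knThm2_tau_sub` twice and
`threeRelays_cert_of_defect_arith`. [cite: KozmaNitzan2024, Theorem 2 (§3.2, pp. 8–9)] -/
theorem threeRelays_regionCert_of_defectBound (w : Sym2 (Fin n) → unitInterval) (o b a₁ a₂ a₃ : Fin n)
    (h31 : (prodBernoulli w).real (openConn a₃ b) ≤ (prodBernoulli w).real (openConn a₁ b))
    (h32 : (prodBernoulli w).real (openConn a₃ b) ≤ (prodBernoulli w).real (openConn a₂ b))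
    (hK : ((prodBernoulli w).real ((openConn a₁ a₃)ᶜ ∩ (openConn a₂ a₃)ᶜ ∩ (openConn a₁ o ∪ openConn a₂ o)) *
              (prodBernoulli w).real ((openConn a₁ a₂)ᶜ ∩ (openConn a₁ a₃)ᶜ : Set (BondConfig (Fin n))) *
              (prodBernoulli w).real ((openConn a₂ a₁)ᶜ ∩ (openConn a₂ a₃)ᶜ : Set (BondConfig (Fin n))) -
            (prodBernoulli w).real ((openConn a₁ a₂)ᶜ ∩ (openConn a₁ a₃)ᶜ ∩ openConn a₁ o) *
              (prodBernoulli w).real ((openConn a₁ a₃)ᶜ ∩ (openConn a₂ a₃)ᶜ : Set (BondConfig (Fin n))) *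
              (prodBernoulli w).real ((openConn a₂ a₁)ᶜ ∩ (openConn a₂ a₃)ᶜ : Set (BondConfig (Fin n))) -
            (prodBernoulli w).real ((openConn a₂ a₁)ᶜ ∩ (openConn a₂ a₃)ᶜ ∩ openConn a₂ o) *
              (prodBernoulli w).real ((openConn a₁ a₃)ᶜ ∩ (openConn a₂ a₃)ᶜ : Set (BondConfig (Fin n))) *
              (prodBernoulli w).real ((openConn a₁ a₂)ᶜ ∩ (openConn a₁ a₃)ᶜ : Set (BondConfig (Fin n)))) *
          ((prodBernoulli w).real ((openConn a₁ a₃)ᶜ ∩ (openConn a₂ a₃)ᶜ ∩ openConn a₃ b) -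
            (prodBernoulli w).real ((openConn a₁ a₃)ᶜ ∩ (openConn a₂ a₃)ᶜ ∩ (openConn a₁ b ∩ openConn a₂ b))) ≤
        (prodBernoulli w).real ((openConn a₁ a₂)ᶜ ∩ (openConn a₁ a₃)ᶜ : Set (BondConfig (Fin n))) *
            (prodBernoulli w).real ((openConn a₂ a₁)ᶜ ∩ (openConn a₂ a₃)ᶜ : Set (BondConfig (Fin n))) *
            (prodBernoulli w).real ((openConn a₁ a₃)ᶜ ∩ (openConn a₂ a₃)ᶜ : Set (BondConfig (Fin n))) *
          (prodBernoulli w).real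
            ((openConn o a₁ ∪ openConn o a₂ ∪ openConn o a₃)ᶜ ∩ (openConn a₃ b)ᶜ : Set (BondConfig (Fin n)))) :
    0 ≤
      (prodBernoulli w).real ((openConn a₁ a₃)ᶜ ∩ (openConn a₂ a₃)ᶜ ∩ (openConn a₁ o ∪ openConn a₂ o)) *
            (prodBernoulli w).real ((openConn a₁ a₂)ᶜ ∩ (openConn a₁ a₃)ᶜ : Set (BondConfig (Fin n))) *
            (prodBernoulli w).real ((openConn a₂ a₁)ᶜ ∩ (openConn a₂ a₃)ᶜ : Set (BondConfig (Fin n))) *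
          ((prodBernoulli w).real ((openConn a₁ a₃)ᶜ ∩ (openConn a₂ a₃)ᶜ ∩ (openConn a₁ b ∩ openConn a₂ b)) -
            (prodBernoulli w).real ((openConn a₁ a₃)ᶜ ∩ (openConn a₂ a₃)ᶜ ∩ openConn a₃ b)) +
        (prodBernoulli w).real ((openConn a₁ a₂)ᶜ ∩ (openConn a₁ a₃)ᶜ ∩ openConn a₁ o) *
            (prodBernoulli w).real ((openConn a₁ a₃)ᶜ ∩ (openConn a₂ a₃)ᶜ : Set (BondConfig (Fin n))) *
            (prodBernoulli w).real ((openConn a₂ a₁)ᶜ ∩ (openConn a₂ a₃)ᶜ : Set (BondConfig (Fin n))) *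
          ((prodBernoulli w).real ((openConn a₁ a₂)ᶜ ∩ (openConn a₁ a₃)ᶜ ∩ openConn a₁ b) -
            (prodBernoulli w).real ((openConn a₁ a₂)ᶜ ∩ (openConn a₁ a₃)ᶜ ∩ (openConn a₂ b ∩ openConn a₃ b))) +
        (prodBernoulli w).real ((openConn a₂ a₁)ᶜ ∩ (openConn a₂ a₃)ᶜ ∩ openConn a₂ o) *
            (prodBernoulli w).real ((openConn a₁ a₃)ᶜ ∩ (openConn a₂ a₃)ᶜ : Set (BondConfig (Fin n))) *
            (prodBernoulli w).real ((openConn a₁ a₂)ᶜ ∩ (openConn a₁ a₃)ᶜ : Set (BondConfig (Fin n))) *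
          ((prodBernoulli w).real ((openConn a₂ a₁)ᶜ ∩ (openConn a₂ a₃)ᶜ ∩ openConn a₂ b) -
            (prodBernoulli w).real ((openConn a₂ a₁)ᶜ ∩ (openConn a₂ a₃)ᶜ ∩ (openConn a₁ b ∩ openConn a₃ b))) +
        (prodBernoulli w).real ((openConn a₁ a₂)ᶜ ∩ (openConn a₁ a₃)ᶜ : Set (BondConfig (Fin n))) *
            (prodBernoulli w).real ((openConn a₂ a₁)ᶜ ∩ (openConn a₂ a₃)ᶜ : Set (BondConfig (Fin n))) *
            (prodBernoulli w).real ((openConn a₁ a₃)ᶜ ∩ (openConn a₂ a₃)ᶜ : Set (BondConfig (Fin n))) *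
          (prodBernoulli w).real
            ((openConn o a₁ ∪ openConn o a₂ ∪ openConn o a₃)ᶜ ∩ (openConn a₃ b)ᶜ : Set (BondConfig (Fin n))) := by
  -- the two worst-relay gaps on the atoms (KN eq. (7))
  have hγ₁ := knThm2_tau_sub w b a₁ a₂ a₃
  have hγ₂ := knThm2_tau_sub w b a₂ a₁ a₃
  -- normalise the swapped set expressions in `hγ₂`
  have e1 : ((openConn a₂ a₃)ᶜ ∩ (openConn a₁ a₃)ᶜ : Set (BondConfig (Fin n))) =
      (openConn a₁ a₃)ᶜ ∩ (openConn a₂ a₃)ᶜ := Set.inter_comm _ _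
  have e2 : (openConn a₂ b ∩ openConn a₁ b : Set (BondConfig (Fin n))) = openConn a₁ b ∩ openConn a₂ b :=
    Set.inter_comm _ _
  rw [e1, e2] at hγ₂
  set P₁₂ := (prodBernoulli w).real ((openConn a₁ a₃)ᶜ ∩ (openConn a₂ a₃)ᶜ : Set (BondConfig (Fin n)))
  set P₁ := (prodBernoulli w).real ((openConn a₁ a₂)ᶜ ∩ (openConn a₁ a₃)ᶜ : Set (BondConfig (Fin n)))
  set P₂ := (prodBernoulli w).real ((openConn a₂ a₁)ᶜ ∩ (openConn a₂ a₃)ᶜ : Set (BondConfig (Fin n)))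
  set A₁₂ := (prodBernoulli w).real ((openConn a₁ a₃)ᶜ ∩ (openConn a₂ a₃)ᶜ ∩ (openConn a₁ o ∪ openConn a₂ o))
  set A₁ := (prodBernoulli w).real ((openConn a₁ a₂)ᶜ ∩ (openConn a₁ a₃)ᶜ ∩ openConn a₁ o)
  set A₂ := (prodBernoulli w).real ((openConn a₂ a₁)ᶜ ∩ (openConn a₂ a₃)ᶜ ∩ openConn a₂ o)
  set m₁₂ := (prodBernoulli w).real ((openConn a₁ a₃)ᶜ ∩ (openConn a₂ a₃)ᶜ ∩ (openConn a₁ b ∩ openConn a₂ b))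
  set m₃ := (prodBernoulli w).real ((openConn a₁ a₃)ᶜ ∩ (openConn a₂ a₃)ᶜ ∩ openConn a₃ b)
  set m₁ := (prodBernoulli w).real ((openConn a₁ a₂)ᶜ ∩ (openConn a₁ a₃)ᶜ ∩ openConn a₁ b)
  set m₂₃ := (prodBernoulli w).real ((openConn a₁ a₂)ᶜ ∩ (openConn a₁ a₃)ᶜ ∩ (openConn a₂ b ∩ openConn a₃ b))
  set m₂ := (prodBernoulli w).real ((openConn a₂ a₁)ᶜ ∩ (openConn a₂ a₃)ᶜ ∩ openConn a₂ b)
  set m₁₃ := (prodBernoulli w).real ((openConn a₂ a₁)ᶜ ∩ (openConn a₂ a₃)ᶜ ∩ (openConn a₁ b ∩ openConn a₃ b))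
  set D := (prodBernoulli w).real
    ((openConn o a₁ ∪ openConn o a₂ ∪ openConn o a₃)ᶜ ∩ (openConn a₃ b)ᶜ : Set (BondConfig (Fin n)))
  have hg1 : 0 ≤ (m₁₂ + m₁) - (m₂₃ + m₃) := by linarith
  have hg2 : 0 ≤ (m₁₂ + m₂) - (m₁₃ + m₃) := by linarith
  exact threeRelays_cert_of_defect_arith measureReal_nonneg measureReal_nonneg measureReal_nonneg
    measureReal_nonneg measureReal_nonneg hg1 hg2 hK

end

end Summit.CriticalPhenomena.PercolationContinuityZ3.Theorems
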